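import Mathlib
import HarnessLib
import HarnessLib.Audit
import Summits.ResolutionOfSingularities.Statement
import Literature.AlgebraicGeometry.Resolution.MarkedIdeals
import HarnessLib.Audit.Status.Attr

/-!
Route: MarkedTransfer

# Route MarkedTransfer — Kollár's char-0 proof ported — everything transfers but maximal contact;
the residue is hypersurface order reduction in char p

TRANSFER route (lens = transfer; sibling = characteristic 0, Hironaka/Kollár). It suffices to show X
= HOR ∧ H2R ∧ D:
(HOR = HypersurfaceOrderReduction, crux rank 2) HYPERSURFACE ORDER REDUCTION in characteristic p —
for every prime p, every perfect field k of char p, every regular integral separated k-scheme X of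
finite type, every nonzero EFFECTIVE CARTIER ideal sheaf I (`IsEffectiveCartier`, Blowups.lean:
locally one nonzerodivisor — on integral X the same as locally principal and nonzero), every
simple-normal-crossings boundary E and every m ≥ 1, the marked ideal (X, I, E, m) admits a marked
resolution in the tree's sense (`IsMarkedResolution`: finitely many blow-ups in regular centres
inside supp(I_i, m) = {ord ≥ m}, snc with E_i, controlled transforms, ending with supp = ∅) —
verbatim the "open problem (in positive characteristic)" of BenitoVillamayoru2013 (simplification of
the n-fold points of a hypersurface) and the ONE step of the sibling's proof that does not transfer
(Kollár 3.74 (3) ⇒ 3.80, maximal contact); (H2R = HypersurfaceToResolution, crux rank 3, NEW in rev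
2) HOR ⇒ every reduced separated scheme of finite type over every PERFECT field of char p has a
resolution (`Scheme.HasResolution`) — verbatim the antecedent of D; (D = DescentPerfectToAll, crux
rank 4, stmt-0549 shared) perfect fields ⇒ all fields.
H2R carries two lines. (A, direct, classical — recorded by the rev-2 repair) every integral
projective Z over a perfect field k is FINITE AND BIRATIONAL onto a hypersurface H (an integral
effective Cartier divisor) of a REGULAR quasi-projective (d+1)-fold V over k: Kedlaya2004 Thm 1
(arXiv:math/0303382: a finite Z → ℙ^d étale off the hyperplane at infinity exists over ANY field of
char p for geometrically reduced Z — "improves an earlier result … restricted to infinite perfect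
fields") or, over infinite k, generic linear projection (tree:
`WeightedThesis.HypersurfaceModel.*`); then a primitive element, twisted into Γ(Z, f^*O(i)), and its
minimal polynomial over the polynomial charts cut H out of V = the total space of O_{ℙ^d}(i); HOR
applied to (V, 𝓘_H, ∅, 1) plus `IsMarkedResolution.hasResolution` (BGMW §3.3 (1)⇒(4) = Kollár's
proof of Cor. 3.22, char-free, PROVED in EffectiveResolutionMarked) resolves H; a resolution of H is
normal, hence factors through Z
(`WeightedThesis.FiniteBirationalTransfer.stub_finiteBirationalTransfer`, LANDED); and the
projective integral case suffices
(`WeightedThesis.ProjectiveIntegralSuffices.stub_projectiveIntegralSuffices`, LANDED). (B,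
sibling-faithful) HOR ⇒ the TRANSFERRED SIBLING THEOREM MarkedOrderReductionP (target, rank 0:
Kollár 2007 Thm 3.69 (1) with E = ∅ at char p over perfect fields, the char-p twin of the tree's
`Kollar2007MarkedOrderReduction`) — the support HypersurfaceToMarked (Kollár 3.70 with maximal
contact replaced by hypersurface presentations / elimination algebras; crux #3 until rev 1, a
support since rev 2 because line A bypasses it) — followed by the support OrderReductionToResolution
(S1 = Kollár 3.72 + Cor. 3.22 + projective reduction, char-free, PROVED from the tree in the rev-0
deciding theorem, commit 87c143f06d26; uses `IsMarkedResolution.hasResolution`,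
`isRegular_projectiveSpace`, `isIntegral_projectiveSpace`, `stub_projectiveIntegralSuffices`): H2R =
`fun hA => hS (hB hA)` (Sketch.lean rc 0). Either way the TRANSFER residue is exactly HOR:
hypersurface (embedded, with boundary) order reduction is all that characteristic p withholds from
Kollár's proof of the weak summit over perfect fields.
Cards linked (as named LINES on HOR, not as items): ifp-third-arrow-monomial-to-tight
(Kawanoue–Matsuki monomial case, graded known), critical-values-move (earned transversal contact at
wild points of height one, graded new-mechanism).
Lean: `HypersurfaceOrderReduction ∧ HypersurfaceToResolution ∧ DescentPerfectToAll`

## Assembly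
Deciding theorem (rev 2, crux-only) `closes (hA : HypersurfaceOrderReduction) (hB :
HypersurfaceToResolution) (hD : DescentPerfectToAll) : _root_.ResolutionOfSingularities := fun p hp
=> hD p hp (hB hA p hp)` (glue.lean = Sketch.lean: lean check rc 0, 0 sorries, axioms propext ·
Classical.choice · Quot.sound): fix a prime p; `hB hA p hp` is resolution of every reduced separated
finite-type scheme over every perfect field of char p, verbatim the antecedent of `hD p hp`, which
upgrades it to `ResolutionInChar p`. No support or target is a hypothesis (rev 1 assumed the support
OrderReductionToResolution: `glue.non-crux-hypothesis`, human ruling 2026-08-16); the supports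
HypersurfaceToMarked / OrderReductionToResolution and the target MarkedOrderReductionP document line
B and are proved, if at all, in Theorems files that may import EffectiveResolutionMarked /
ProjectiveSpaceRegular / the WeightedThesis theorems (PROVED cone) — only this ROUTE file stays
import-clean. The Assembly item is the type of `closes` (provable at once: `fun hA hB hD => closes
hA hB hD`).
IMPORT CONE (rev 1, unchanged in rev 2): besides the Statement this file imports only `MarkedIdeals`
(→ `Blowups`, `ResolutionOfSingularities`); ledger deps cone 0 unproved / 29 project constants
(staffable). The rev-0 imports Principalization / EffectiveResolutionMarked / ProjectiveSpaceRegular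
/ Theorems.WeightedInvariantWeightedThesisProjectiveIntegralSuffices dragged in 17 unproved named
facts no item uses (CossartPiltant2019Principalization, CossartPiltant2019General / LU3 /
LU3OfComplete / LUComplete3 / Patching, CossartJannsenSaito2020 + CossartJannsenSaito2020General,
Temkin2013, BierstoneGrigorievMilmanWlodarczyk2011, AbramovichOortConjecture, DeJong1996Projective /
InductionStep / Strong / StrongAlgClosed / StrongPerfect / NormalProjectiveStep); the two residual
module-level cone facts, `Literature.AlgebraicGeometry.Resolution.ResolutionOfSingularities` (the
summit itself) and `CossartPiltant2019`, live in the Statement's own module and ride with every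
route of this summit (needs-fact: none).

Rationale: WHY THIS LINE. Transfer lens, sibling = characteristic zero: the tree already decomposes
`Hironaka1964` down to the single named fact
`Kollar2007MarkedOrderReduction` (KollarOrderReduction.lean: Thm 3.69 ⇒ 3.72 ⇒ 3.21 ⇒ 3.22 ⇒ 3.36,
all proved), so the sibling's proof
is laid out IN THE TREE and the port can be audited step by step: S1 (order reduction ⇒
principalization ⇒ resolution, Kollár 3.72/3.22
+ Chow) is char-free and re-proved at char p from the tree (rev-0 glue; since rev 1 the support
OrderReductionToResolution — NOT a
hypothesis of `closes` since rev 2); S2 (marked ideals, controlled transforms, derivative ideals,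
cosupport
via D^{m−1}, Kollár §3.7) transfers once iterated first-order derivations are replaced by
Hasse–Schmidt differential operators
(Villamayoru2014 §2; BravoVillamayor2010 Part II); S6 (the monomial case, Kollár 3.111 Step 3; tree
MonomialOrderReduction.lean) and the
bookkeeping of §§3.12–3.13 are char-free; S4–S5 (going down/up, uniqueness and tuning, §§3.9–3.11)
run verbatim as soon as the
differential closure of (I, m) has a section of degree 1 and order 1 at the point (persistence is
then free). The FIRST step that does not transfer is S3 = Kollár Lemma 3.74 (3) (p. 153, flagged
"char. 0
only!") ⇒ Thm 3.80 (hypersurfaces of maximal contact exist: MC(I) = D^{m−1}(I) has order 1 where ord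
I = m; tree:
`KollarMaximalContact.exists_maxContact_nhd [CharZero k]`). Why it worked there: a degree-m form
over ℚ has a nonzero partial of degree
m−1 (Euler). What the summit lacks: at a WILD point — one where every degree-m initial form of I
lies in k[y₁^p,…,yₙ^p] — all Hasse
derivatives of order ≤ m−1 have order ≥ 2 and no smooth hypersurface need contain the top locus at
all (Narasimhan, Kollár Aside 3.57;
tree
`Literature.Barriers.ResolutionOfSingularities.Narasimhan1983_noSmoothHypersurfaceThroughTopLocus`),
nor persist (Hauser2003 §14;
CossartJannsenSaito2020 Ch. 15). What replaces it in print: Villamayor–Bravo transversal projection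
+ elimination algebras ("a substitute to
restricting to a hypersurface of maximal contact", BravoVillamayor2010 §1; any characteristic,
perfect k) and Kawanoue–Matsuki's leading
generator systems (KawanoueMatsuki2016) both restore the induction ("Step A / Step 1 works in
arbitrary dimension") and DISPLACE the break
to the terminal case: "the containment β_s(Sing 𝒢_s^{(d)}) ⊂ Sing 𝒢_s^{(d−m)} may be strict, and
then a resolution [downstairs] may not
lift" (BravoVillamayor2010 p. 44) — the weak-vs-strong monomial case of BenitoVillamayoru2013, the
"third arrow" of KawanoueMatsuki2015,
home of the Moh–Hauser kangaroo (Moh1987, HauserPerlega2019). The crux is therefore typed as the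
smallest classical statement that
contains every wild specimen and to which the general case is reduced in print by hypersurface
presentations: HYPERSURFACE ORDER REDUCTION
(BenitoVillamayoru2013 abstract: "The open problem (in positive characteristic) is to prove that
there is an n-sequence such that the
final strict transform of X has no points of multiplicity n"; Villamayoru2014 §2.20: étale-locally
F_n(X) = ∩ Sing(H_i, n_i) for
hypersurfaces H_i, any characteristic; BravoVillamayor2010 p. 4: treating the hypersurface monomial
case "would imply resolution of
singularities over arbitrary fields"). Imported area: none beyond the sibling's own; catalogue
entries used: certified transfer (S1 kernel-checked, rev 0), toy-model ladder (dim ≤ 3 known, dim 4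
= embedded
threefold hypersurfaces open). What no listed route does: Valuative/CyclicCovers hold the
VALUATION-LOCAL shadows and patch;
WeightedInvariant changes the move class (weighted centres) and posits a datum; pAlteration /
WildQuotients alter; Descent /
UniformComplexity / UniversalCells move the ground field or the family; CleanCovers /
FrobeniusLadder change the object. Nobody keeps Hironaka's smooth-centre marked calculus — the
tree's own vocabulary — and files its char-p twin with the seam at
Thm 3.80 made a typed item. Rev 2 (glue repair): the consumer of HOR is the crux
HypersurfaceToResolution, which besides the
sibling's HOR ⇒ MOR_p ⇒ resolution (line B) has a DIRECT classical proof (line A: finite birational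
hypersurface models in a regular
ambient, Kedlaya2004 Thm 1 + twisted primitive element; a resolution of the model is normal and
factors through Z) — the residue of the
transfer is HOR ALONE; marked ideals of codimension ≥ 2, the home of maximal contact, leave the
critical path of the weak summit.

RANKED CRUXES. #0 MarkedOrderReductionP (target) — the transferred sibling theorem — Kollár 2007 Thm
3.69 (1) with empty boundary at characteristic p over PERFECT fields: for every perfect field k of
char p, every regular integral separated k-scheme X of finite type, every ideal sheaf I ≠ 0 and
every m ≥ 1, the marked ideal (X, I, ∅, m) admits a marked resolution (`IsMarkedResolution`). The
waypoint of line B of HypersurfaceToResolution (the support HypersurfaceToMarked gives it from HOR,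
the support OrderReductionToResolution consumes it); not a hypothesis of `closes`; its char-0 twin
is the tree's `Kollar2007MarkedOrderReduction`. (why it might fail: it is embedded resolution (order
reduction) in char p, open from dim 4; implied by no theorem of the weak summit, so possibly
strictly harder than the Statement; refutable only by an explicit marked ideal with no order-m
blow-up sequence.) [Kollar2007, BenitoVillamayoru2013, KawanoueMatsuki2016, CossartPiltant2019]
#2 HypersurfaceOrderReduction (crux) — HYPERSURFACE ORDER REDUCTION in char p (the first
non-transferring step, typed): for every prime p, perfect field k of char p, regular integral
separated finite-type X/k, nonzero EFFECTIVE CARTIER ideal sheaf I (`IsEffectiveCartier`,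
Blowups.lean: locally one nonzerodivisor; on integral X the same as locally principal and nonzero —
rev-1 re-typing off Principalization.lean, whose import cone is polluted), snc boundary E (`HasSNC
E`) and m ≥ 1, the marked ideal (X, I, E, m) admits a marked resolution — blow-ups in regular
centres inside {ord ≥ m}, snc with the boundary, controlled (= strict, while m is the maximal order)
transforms, ending with no point of order ≥ m. Contains every catalogued wild specimen (Narasimhan,
Moh, Hauser's kangaroo, Hauser–Perlega, Cossart–Piltant Rem 3.2); dim X ≤ 3 is the support
HypersurfaceOrderReductionDimLeThree; dim X = 4 is embedded resolution of threefold hypersurfaces,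
open. [difficulty: open-problem] (why it might fail: contains embedded resolution of threefold
hypersurfaces z^p+g in A^4 (open: KawanoueMatsuki2016 §1, CossartPiltant2019 §1) and every kangaroo
family; no terminating invariant is known at wild points from ambient dim 4; not implied by the weak
summit.) [BenitoVillamayoru2013, BravoVillamayor2010, KawanoueMatsuki2016, KawanoueMatsuki2015,
Moh1987, HauserPerlega2019, Kollar2007, Berczi2026,
Literature.Barriers.ResolutionOfSingularities.Narasimhan1983_noSmoothHypersurfaceThroughTopLocus]
#3 HypersurfaceToResolution (crux, NEW rev 2) — HOR ⇒ RESOLUTION OVER PERFECT FIELDS: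
HypersurfaceOrderReduction → for every prime p, perfect k of char p and reduced separated
finite-type X/k, `Scheme.HasResolution X` (verbatim the antecedent of DescentPerfectToAll; consumed
by `closes`). Line A (direct, classical): projective integral Z suffices
(`stub_projectiveIntegralSuffices`, landed); a finite f : Z → ℙ^d étale off the hyperplane at
infinity (Kedlaya2004 Thm 1, ANY field of char p; generic projection over infinite k, tree
`WeightedThesis.HypersurfaceModel.*`) gives a primitive element regular over 𝔸^d whose twisted
minimal polynomial χ cuts an integral effective Cartier divisor H = V(χ) out of the regular V =
total space of O_{ℙ^d}(i), with Z → H finite birational; HOR(V, 𝓘_H, [], 1) +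
`IsMarkedResolution.hasResolution` (proved) resolve H, `stub_finiteBirationalTransfer` (landed)
resolves Z. Line B (sibling): HypersurfaceToMarked then OrderReductionToResolution. [deps:
HypersurfaceOrderReduction] [difficulty: XL] (why it might fail: line A — over FINITE perfect k the
hypersurface model rests on Kedlaya2004 Thm 1 + a twisted minimal-polynomial construction, classical
but unformalised (XL); line B inherits HypersurfaceToMarked's gap, possibly as hard as MOR_p.)
[Kedlaya2004, arXiv:math/0303382, Kollar2007, BierstoneGrigorievMilmanWlodarczyk2011,
Hartshorne1977, StacksProject]
#4 DescentPerfectToAll (crux) — PerfectToAll (shared verbatim with routes Descent /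
WeightedInvariant / CleanCovers / UniversalCells, stmt-0549): for a prime p, resolution of all
reduced separated finite-type schemes over all PERFECT fields of char p implies ResolutionInChar p.
[difficulty: open-problem] (why it might fail: regular is not geometrically regular under
inseparable k/K0 (EGA IV 6.7.4); resolve-a-model-then-base-change needs k/K0 separable, impossible
beyond the p-rank of k; Frobenius twist resolves only a twist of X; open already for quadrics in
char 2.) [Temkin2008, CossartPiltant2009, Kollar2007,
Literature.Barriers.ResolutionOfSingularities.InseparableBaseChange,
Literature.Barriers.ResolutionOfSingularities.InseparableBaseChangeResolution]
#9 HypersurfaceToMarked (support since rev 2; was crux #3) — HYPERSURFACE PRESENTATIONS, line B of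
HypersurfaceToResolution (first half): HypersurfaceOrderReduction → MarkedOrderReductionP (Kollár
3.70 with maximal contact replaced by Villamayor's presentations F_n = ∩ Sing(H_i, n_i) /
Bravo–Villamayor elimination / Kawanoue–Matsuki Step 1). Demoted because line A bypasses marked
ideals of codimension ≥ 2; kept as the typed sibling-faithful lemma (it closes every EMBEDDED
consumer, not only the weak summit). (why it might fail: existential simplification of each H_i
gives no invariant to synchronise a presentation or glue étale-local data — may be as hard as
MOR_p.) [difficulty: XL] [Villamayoru2014, BravoVillamayor2010, KawanoueMatsuki2016,
BenitoVillamayoruriburu2015, Kollar2007]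
#9 OrderReductionToResolution (support) — the TRANSFERRED step S1 (Kollár 3.72 + Cor. 3.22 +
projective reduction), char-free, line B of HypersurfaceToResolution (second half):
MarkedOrderReductionP ⇒ resolution of every reduced separated finite-type scheme over every perfect
field of char p. A hypothesis of `closes` in rev 1 only (removed in rev 2: crux-only rule). PROVED
from the tree in the rev-0 deciding theorem (commit 87c143f06d26, `have hR :
OrderReductionToResolution := by …`, lean check rc 0; uses `IsMarkedResolution.hasResolution`,
`isRegular_projectiveSpace`, `isIntegral_projectiveSpace`, `stub_projectiveIntegralSuffices`): a
prover lands that script in a Theorems/ file importing EffectiveResolutionMarked,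
ProjectiveSpaceRegular, Theorems.WeightedInvariantWeightedThesisProjectiveIntegralSuffices.
[difficulty: provable-now] [Kollar2007, BierstoneGrigorievMilmanWlodarczyk2011, CossartPiltant2019]
#9 HypersurfaceOrderReductionDimLeThree (support) — CALIBRATION (known case):
HypersurfaceOrderReduction (rev-1 typing, `IsEffectiveCartier`) for X of topological Krull dimension
≤ 3 — order reduction for curves and SURFACES in regular ambient schemes of dimension ≤ 3 with
boundary, i.e. the B-permissible canonical embedded resolution of two-dimensional excellent schemes
(CossartJannsenSaito2020, Thm 1.3 / Ch. 5 with boundary) and Kawanoue–Matsuki's IFP in dimension 3;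
expected to close modulo a cite fact for CJS. [difficulty: L] [CossartJannsenSaito2020,
KawanoueMatsuki2016, BenitoVillamayoru2011]

TWO-LAYER PLAN. Foreseen glued splits (k ≤ 3, depth 1), none filed now. HypersurfaceToResolution ⇐
HypersurfaceModelsPerfect (every
integral closed Z ⊆ ℙⁿ over a PERFECT field k admits a finite birational k-morphism onto an integral
effective Cartier divisor H of a regular
integral separated finite-type V/k — Kedlaya2004 Thm 1 + twisted primitive element; the
algebraically-closed cousin with ℙ^m ambient is
EquisingularLift's crux HypersurfaceModels, stmt-16072) → HORResolvesDivisors (HOR ⇒ every integral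
effective Cartier divisor H of such a
V has a resolution: m = 1, E = [], `IsMarkedResolution.hasResolution`) → HypersurfaceToResolution
(glue = `stub_projectiveIntegralSuffices`
+ `stub_finiteBirationalTransfer`, both landed); line B's split is HypersurfaceToMarked →
OrderReductionToResolution → HypersurfaceToResolution (items; glue
`fun hB hS hA => hS (hB hA)`). HypersurfaceOrderReduction ⇐ TameLocusTransfer (order reduction at
TAME
points — some degree-m initial form not a p-th power — by the char-0 argument with Hasse–Schmidt
operators; Kollár 3.70 verbatim,
"maximal contact works when ord < char" being its sub-case, Kollár 2.57/3.57) →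
WildHypersurfaceOrderReduction (the residual: locally
Weierstrass p^e-forms z^{p^e} + a_1 z^{p^e−1} + … + a_{p^e} with snc boundary = KM's monomial case
with τ = 1 / BeV's weak-to-strong
monomial passage) → HypersurfaceOrderReduction. HypersurfaceToMarked ⇐ PresentationStability
(Villamayor's local presentation F_n = ∩
Sing(H_i,n_i) persists along permissible sequences, any char — printed) → SimultaneousSimplification
(a finite family of hypersurface
markings on one regular X admits a COMMON order-reduction sequence — Hironaka's trick makes it a
non-principal marked ideal, so this is
where the lemma bites) → HypersurfaceToMarked (line B only). A dimension ladder of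
HypersurfaceOrderReduction (dim 4 = threefold hypersurfaces, the
frontier instance; Berczi2026's benchmark germs z³ + … in char 3) is the natural first child if a
prover wants a bounded target.

KILL CRITERIA. ¬HypersurfaceOrderReduction at some prime (an explicit effective divisor on a regular
variety over a perfect field with NO order-m
marked blow-up sequence) refutes embedded resolution by smooth-centre blow-ups in char p: close the
route `refuted:HypersurfaceOrderReduction`
(the summit survives; WeightedInvariant's weighted centres and the alteration/valuative routes are
untouched) and file the witness as a
barrier. A refutation that is an artefact of the typing (`HasSNC`, `IsEffectiveCartier`,
`IsMarkedResolution` read too literally) ⇒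
restate once (misstated). HypersurfaceToResolution cannot be refuted short of HOR ∧ ¬(resolution
over some perfect field),
i.e. never usefully; if its line A is shown mistyped over FINITE fields (it should not be:
Kedlaya2004 Thm 1 is stated for every field of
char p), line A is restricted to infinite perfect fields and finite fields go through line B or
through DescentAlgclosedToPerfect
(stmt-0550, EquisingularLift) — a tenure edit, not a kill. The support HypersurfaceToMarked cannot
be refuted short of
¬MarkedOrderReductionP ∧ HOR; if a refuter shows HOR as typed CARRIES NO REDUCTION for line B
(existential HOR feeds no presentation
mechanism) nothing breaks since rev 2 (line A needs existence only); a canonical form of HOR (an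
order-reduction FUNCTOR on hypersurface
markings compatible with smooth morphisms, Kollár 3.69 (2)) is filed only if some consumer needs it.
¬DescentPerfectToAll confines the line to perfect fields (convert to a conditional bridge or
retire). Proved
elsewhere: MarkedOrderReductionP by any route closes HypersurfaceToResolution through S1; resolution
over perfect fields by any route
(WeightedInvariant, CleanCovers, …) moots cruxes 2–3 for the summit; the summit by LU + patching
does NOT moot HOR (embedded ≠ weak).

NOT DECOMPOSED YET. The tame/wild split of HypersurfaceOrderReduction (needs a Literature definition
of Hasse–Schmidt differential operators / the order-m
initial form at a scheme point — not in Mathlib; `derivIdealIter` iterates first-order derivations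
and is wrong in char p); the LINES on the
wild part — (a) Kawanoue–Matsuki's inv_MON with eventual decrease (KawanoueMatsuki2015), (b)
Benito–Villamayor's H-ord / weak→strong
monomial case (BenitoVillamayoru2013, BenitoVillamayoruriburu2015), (c) card critical-values-move,
(d) machine-found delayed ranking functions
(Berczi2026) — are crux-ideas for HypersurfaceOrderReduction (`idea add --crux`), not items; the two
line-A children of HypersurfaceToResolution (HypersurfaceModelsPerfect, HORResolvesDivisors —
TWO-LAYER
PLAN) are filed by tenure when a prover claims the crux, not now; functoriality (Kollár 3.69 (2)) is
deliberately NOT in the target (the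
tree's char-0 fact drops it too) and returns only if a consumer of line B needs it; imperfect ground
fields stay in DescentPerfectToAll (derivative criteria for
order fail at points with inseparable residue field: (t^p − a) has order 1 but all Hasse derivatives
vanish).

CHEAPEST FALSIFIER. (i) Lookup, done 2026-08-16: is "hypersurface simplification ⇒ resolution" in
print? BravoVillamayor2010 p. 4 asserts it for the
canonically reached hypersurface MONOMIAL case (citing Benito–Villamayor); Villamayoru2014
§2.20/Rem. 2.19 (2) presents F_n(X) as Sing 𝒢
of a hypersurface-generated Rees algebra in any characteristic — HypersurfaceToMarked is printed up
to the simultaneity gap named in its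
why-might-fail; no counter-indication found. (ii) Typing check a refuter runs first (in-Lean):
instantiate HypersurfaceOrderReduction with
X = 𝔸²_k, I = (y² − x³) (one nonzerodivisor: `IsEffectiveCartier`), E = [], m = 2 and exhibit the
one-blow-up marked resolution via `IsMultipleBlowup.single` + the tree's affine
blow-up charts; then E = [(x)] to exercise `HasSNCWith` — confirms the binders are satisfiable as
intended. (iii) The LINE is cheapest
tested on Berczi2026's benchmark: run the char-3, ambient-dim-4 germs z³ + … through smooth-centre
permissible moves with KM's inv_MON
extended naively to dim 4 (kit); a forced cycle shows line (a) needs a new dim-4 ingredient, as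
KawanoueMatsuki2015 expect. (iv) HypersurfaceToResolution, line A — lookup done 2026-08-16:
Kedlaya2004 (arXiv:math/0303382) Thm 1, p. 1, "every geometrically
reduced projective variety of pure dimension n over a field of positive characteristic admits a
[finite] morphism to projective n-space, étale
away from the hyperplane H at infinity … improves an earlier result … restricted to infinite perfect
fields"; in-Lean check a refuter runs
first: for V = 𝔸^{d+1}_k ⊃ H = V(χ), χ monic and prime, exhibit `IsEffectiveCartier` + `HasSNC []`,
i.e. (V, 𝓘_H, [], 1) instantiates HOR.

NUMBERS. Known: dim X ≤ 3 all p (CossartJannsenSaito2020; KawanoueMatsuki2016;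
BenitoVillamayoru2011: surfaces); char 0 all dims (Kollar2007
Thm 3.69, tree `Kollar2007MarkedOrderReduction` ⇒ `Hironaka1964` proved); ord < p locally behaves as
char 0 (Kollár 2.57/3.57;
Cossart 1991 doi:10.1215/s0012-7094-91-06303-9). Open: dim X = 4, already I = (z^p + g(y₁,y₂,y₃))
(KawanoueMatsuki2016 §1; CossartPiltant2019
§1: the non-embedded threefold theorem is NOT obtained by Hironaka-permissible blow-ups). Wild
specimens (all instances of crux 2): Narasimhan x²+yz³+zw³+y⁷w (p = 2, dim 4), Hauser x²+y⁷+yz⁴,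
Hauser–Perlega z^{p³}+F,
Cossart–Piltant Z^p+u₄u₁^p+u₃u₂^p, Moh z^{p^e}+f. Items at open: 7 (3 cruxes, 1 target, 2 supports,
1 assembly); rev 1 (cone repair): same 7, HypersurfaceOrderReduction /
HypersurfaceOrderReductionDimLeThree / Assembly re-typed, imports 5 → 1, unproved cone facts 19 → 2
(both in the Statement's module). Rev 2 (glue repair): 8 items (cruxes HOR 2 /
HypersurfaceToResolution 3 new / DescentPerfectToAll 4; target; supports HypersurfaceToMarked (was
crux 3), OrderReductionToResolution, DimLeThree; Assembly re-typed); `closes` crux-only; imports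
unchanged.

DEFINITION REQUESTS. Not blocking any item: `HasseSchmidtDiff` — differential operators of order ≤ i
of a smooth k-algebra / the sheaf
Diff^{≤ i}_{X/k} and Diff^{≤ m−1}(I) (EGA IV₄ §16.8; Villamayoru2014 §2), topic
Literature/AlgebraicGeometry/Resolution, for the tame/wild
split of crux 2; cite fact wanted: CossartJannsenSaito2020 Thm 1.3 with boundary (arXiv:0905.2191
Intro Thm 3) for HypersurfaceOrderReductionDimLeThree.

Novelty: Searches (2026-08-16): `ledger route show`/Theses files of all 10 open RoS routes (levers listed in
NOTES); `ledger negatives --problem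
ResolutionOfSingularities` (0); Ideas index (110 cards; read ifp-third-arrow-monomial-to-tight
[known], critical-values-move
[new-mechanism], wild-cones-cannot-hide, kangaroo/Moh cluster titles+grades); `lit search --source
zbmath` "Villamayor equimultiplicity
algebraic elimination" (1: arXiv:1312.7836, read pp. 1–9, 23–26), "Bravo Villamayor singularities
positive characteristic stratification"
(2: arXiv:0807.4308 read pp. 1–5, 44, 46; arXiv:1802.02566), "Benito Villamayor monoidal transforms"
(1: arXiv:1004.1803 read pp. 1–3),
"Benito Villamayor techniques 2-dimensional" (1: arXiv:1103.3464), "Kawanoue Matsuki idealistic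
filtration dimension 3" (3: arXiv:1205.4556,
arXiv:1507.05195 read pp. 1–5), "embedded resolution threefold positive characteristic" (1: Cossart
1991 Duke); `lit search --source arxiv`
"embedded resolution singularities threefolds positive characteristic" since 2018 (0); `lit search
--source crossref` "simplification of
singularities positive characteristic Rees algebra elimination" (10; relevant:
doi:10.1512/iumj.2015.64.5492, Włodarczyk Rees-algebra
weighted 2023); `lit frontier ResolutionOfSingularities --since 2021` (30; relevant:
arXiv:2602.06553 read pp. 1–2, arXiv:2602.14266);
`lit bridges --cross any` (30, none relevant); `lit galaxy search "monomial case" / "maximal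
contact" --star all` (noise only; Kollár AM-166
h  [refs: 10.1512/iumj.2015.64.5492, 10.1112/s0010437x1200084x, 1312.7836, 0807.4308, 1802.02566, 1004.1803, 1103.3464, 1205.4556, 1507.05195, 2602.06553, 2602.14266, doi:10.1512/iumj.2015.64.5492, doi:10.1112/s0010437x1200084x, BenitoVillamayoru2013, BravoVillamayor2010, KawanoueMatsuki2016, Villamayoru2014, Kollar2007, Berczi2026]

Barriers (technique_class: marked-ideal order-reduction, hypersurface-presentation): - technique_class: marked-ideal order-reduction, hypersurface-presentation
- Literature.Barriers.ResolutionOfSingularities.Narasimhan1983_noSmoothHypersurfaceThroughTopLocus: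
it blocks exactly "transposing the char-0 induction via a smooth hypersurface of maximal contact
verbatim" — the route does NOT transpose it: Thm 3.80 is named as the non-transferring step and its
whole domain of failure (wild points of hypersurfaces; Narasimhan's x²+yz³+zw³+y⁷w is an instance of
crux 2 with p = 2, dim 4) is filed as the crux, to be attacked by contact-free
(projection/elimination, LGS) or contact-earning (critical-values-move) lines; the bet is that the
residue is smaller than the summit, not that contact exists.
- Literature.Barriers.ResolutionOfSingularities.Hauser2003_kangarooShadeIncrease: applies INSIDE
crux 2 (its specimen x²+y⁷+yz⁴ is a hypersurface marking): any prover running a residual-order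
invariant on a weak-maximal-contact hypersurface meets it; the route prescribes no invariant and
records the KM answer (an invariant allowed to jump with proved eventual decrease,
KawanoueMatsuki2015 §6) as line (a); not evaded, localised.
- Literature.Barriers.ResolutionOfSingularities.hauserPerlega_mohProofBoundFails: same —
Moh-stability-based termination is dead for e ≥ 3 (HauserPerlega2019); crux 2 quantifies over
existence of SOME permissible sequence, which the divergent point-blow-up runs do not refute (they
fix the centres); a line must use non-point centres or delayed ranking (Be

History (route lifecycle, newest last):
- 2026-08-16T16:26:02Z · rev 1: restated HypersurfaceOrderReduction (stmt-ResolutionOfSingularities-15521), HypersurfaceOrderReductionDimLeThree (stmt-ResolutionOfSingularities-15524), Assembly (stmt-ResolutionOfSingularities-15525) — cone repair (route-repair unit rrepair-ResolutionOfSingularities-Mark-6ec7f187, 2026-08-16): imports 5 → 1 — d (planner-rrepair-ResolutionOfSingularities-Mark-6ec7f187-0)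
- 2026-08-16T16:51:21Z · rev 3: restated Assembly (stmt-ResolutionOfSingularities-16157) — glue repair (route-repair gen 2, 2026-08-16): `closes` is now CRUX-ONLY — closes (hA : HypersurfaceOrderReduction) (hB : HypersurfaceToResolution) (hD : Descent (planner-rrepair-ResolutionOfSingularities-Mark-6ec7f187-g2-0)
- 2026-08-25T06:26:29Z · DORMANT — reconciler: no traction for 7.5 d (last activity item-evidence-added at 2026-08-17T19:03:53Z); parked, not closed — `ledger route dormant route-ResolutionOfSing (operator:999:1414428)
- 2026-08-26T17:02:08Z · REACTIVATED — reconciler: reactivated — activity statement-claimed at 2026-08-26T16:25:04Z after parking at 2026-08-25T06:26:29Z (operator:999:3610426)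

sub-problem: ResolutionOfSingularities · status: open · opened planner-plan-lens-ResolutionOfSingularities-transfer-v2-0 2026-08-16T15:43:32Z · rev 3 · ledger route-ResolutionOfSingularities-MarkedTransfer
GENERATED by the gate from the ledger (D-0016/17). Provers cite these decls: `theorem foo : Summit.ResolutionOfSingularities.ResolutionOfSingularities.Theses.MarkedTransfer.<Decl> := …` in Summits/ResolutionOfSingularities/ResolutionOfSingularities/Theorems/<Name>.lean.
-/

namespace Summit.ResolutionOfSingularities.ResolutionOfSingularities.Theses.MarkedTransfer

open scoped BigOperators Topology Manifold Classical MeasureTheory ProbabilityTheory Matrix InnerProductSpace ComplexConjugate ContinuousMap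
open Filter Set Function TopologicalSpace MeasureTheory

attribute [summit_statement] _root_.ResolutionOfSingularities

/-- item stmt-ResolutionOfSingularities-15520 · target · rank 0 · open · by planner
why it might fail: it is embedded resolution (order reduction) in char p, open from dim 4; implied by no theorem of the weak summit, so possibly strictly harder than the Statement; refutable only by an explicit marked ideal with no order-m blow-up sequence.
sources: Kollar2007, BenitoVillamayoru2013, KawanoueMatsuki2016, CossartPiltant2019
[target] the transferred sibling theorem — Kollár 2007 Thm 3.69 (1) with empty boundary at
characteristic p over PERFECT fields: for every perfect field k of char p, every regular integral
separated k-scheme X of finite type, every ideal sheaf I ≠ 0 and every m ≥ 1, the marked ideal (X,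
I, ∅, m) admits a marked resolution (`IsMarkedResolution`). Derived inside `closes` as `hB hA`; its
char-0 twin is the tree's `Kollar2007MarkedOrderReduction`. -/
@[route_item "route-ResolutionOfSingularities-MarkedTransfer"]
def MarkedOrderReductionP : Prop :=
  ∀ p : ℕ, p.Prime → ∀ (k : Type) [Field k] [CharP k p] [PerfectField k] (X : AlgebraicGeometry.Scheme.{0}) (s : X ⟶ AlgebraicGeometry.Spec (.of k)), AlgebraicGeometry.IsSeparated s → AlgebraicGeometry.LocallyOfFiniteType s → AlgebraicGeometry.QuasiCompact s → AlgebraicGeometry.IsIntegral X → Literature.AlgebraicGeometry.Resolution.Scheme.IsRegular X → ∀ (I : X.IdealSheafData), I ≠ ⊥ → ∀ (m : ℕ), 1 ≤ m → ∃ (X' : AlgebraicGeometry.Scheme.{0}) (Φ : X' ⟶ X) (M' : Literature.AlgebraicGeometry.Resolution.MarkedIdeal X'), Literature.AlgebraicGeometry.Resolution.IsMarkedResolution (⟨I, [], m⟩ : Literature.AlgebraicGeometry.Resolution.MarkedIdeal X) Φ M'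

-- earlier HypersurfaceOrderReduction (stmt-ResolutionOfSingularities-15521, replaced 2026-08-16T16:26:02Z -> stmt-ResolutionOfSingularities-16155): retired by None — ∀ p : ℕ, p.Prime → ∀ (k : Type) [Field k] [CharP k p] [PerfectField k] (X : AlgebraicGeometry.Scheme.{0}) (s : X ⟶ AlgebraicGeometry.Spec (.of k)), AlgebraicGeometry.IsSeparated s → AlgebraicGeometry.LocallyOfFiniteType s → AlgebraicGeo
/-- item stmt-ResolutionOfSingularities-16155 · crux · rank 2 · open · by planner
why it might fail: contains embedded resolution of threefold hypersurfaces z^p+g in A^4 (open: KawanoueMatsuki2016 §1, CossartPiltant2019 §1) and every kangaroo family; no terminating invariant is known at wild points from ambient dim 4; not implied by the weak summit.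
sources: BenitoVillamayoru2013, BravoVillamayor2010, KawanoueMatsuki2016, KawanoueMatsuki2015, Moh1987, HauserPerlega2019
[crux] HYPERSURFACE ORDER REDUCTION in char p (the first non-transferring step, typed): for every
prime p, perfect field k of char p, regular integral separated finite-type X/k, nonzero EFFECTIVE
CARTIER ideal sheaf I (`IsEffectiveCartier`, Blowups.lean: locally generated by one nonzerodivisor —
on integral X the same as locally principal and nonzero; rev-1 re-typing off Principalization.lean,
whose import cone is polluted), snc boundary E (`HasSNC E`) and m ≥ 1, the marked ideal (X, I, E, m)
admits a marked resolution — blow-ups in regular centres inside {ord ≥ m}, snc with the boundary,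
controlled (= strict, while m is the maximal order) transforms, ending with no point of order ≥ m.
Contains every catalogued wild specimen (Narasimhan, Moh, Hauser's kangaroo, Hauser–Perlega,
Cossart–Piltant Rem 3.2); dim X ≤ 3 is the support HypersurfaceOrderReductionDimLeThree; dim X = 4
is embedded resolution of threefold hypersurfaces, open. [difficulty: open-problem] -/
@[route_item "route-ResolutionOfSingularities-MarkedTransfer", crux]
def HypersurfaceOrderReduction : Prop :=
  ∀ p : ℕ, p.Prime → ∀ (k : Type) [Field k] [CharP k p] [PerfectField k] (X : AlgebraicGeometry.Scheme.{0}) (s : X ⟶ AlgebraicGeometry.Spec (.of k)), AlgebraicGeometry.IsSeparated s → AlgebraicGeometry.LocallyOfFiniteType s → AlgebraicGeometry.QuasiCompact s → AlgebraicGeometry.IsIntegral X → Literature.AlgebraicGeometry.Resolution.Scheme.IsRegular X → ∀ (I : X.IdealSheafData), I ≠ ⊥ → Literature.AlgebraicGeometry.Resolution.IsEffectiveCartier I → ∀ (E : List X.IdealSheafData), Literature.AlgebraicGeometry.Resolution.HasSNC E → ∀ (m : ℕ), 1 ≤ m → ∃ (X' : AlgebraicGeometry.Scheme.{0}) (Φ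 : X' ⟶ X) (M' : Literature.AlgebraicGeometry.Resolution.MarkedIdeal X'), Literature.AlgebraicGeometry.Resolution.IsMarkedResolution (⟨I, E, m⟩ : Literature.AlgebraicGeometry.Resolution.MarkedIdeal X) Φ M'

/-- item stmt-ResolutionOfSingularities-15885 · crux · rank 3 · open · by planner
why it might fail: Line A: over FINITE perfect k the finite birational hypersurface model in a regular ambient rests on Kedlaya2004 Thm 1 + a twisted minimal-polynomial construction, classical but unformalised (XL); line B inherits HypersurfaceToMarked's gap (may be as hard as MOR_p).
sources: Kedlaya2004, arXiv:math/0303382, Kollar2007, BierstoneGrigorievMilmanWlodarczyk2011, Hartshorne1977, StacksProject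
[crux] HYPERSURFACE ORDER REDUCTION ⇒ RESOLUTION OVER PERFECT FIELDS (rev 2; the summit-side
consumer of HOR, so that `closes` rests on cruxes only): HypersurfaceOrderReduction (all primes)
implies, for every prime p, every perfect field k of char p and every reduced separated k-scheme X
of finite type, `Scheme.HasResolution X` — verbatim the antecedent of DescentPerfectToAll. TWO
LINES. (A, direct, classical) reduce to integral closed Z ⊆ ℙⁿ_k
(`WeightedThesis.ProjectiveIntegralSuffices.stub_projectiveIntegralSuffices`, tree, landed);
Kedlaya2004 Thm 1 (arXiv:math/0303382: over ANY field of char p a geometrically reduced projective Z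
of pure dim d admits a finite f : Z → ℙ^d étale off the hyperplane at infinity — automatic
hypotheses over perfect k; over infinite k generic linear projection, tree
`WeightedThesis.HypersurfaceModel.*`) makes K(Z)/K(ℙ^d) separable; a primitive element t regular
over 𝔸^d, twisted to g = t·y₀^i ∈ Γ(Z, f^*O(i)) (Hartshorne II.5.14), has minimal polynomial χ with
coefficients in the polynomial charts of ℙ^d (normality), so H := V(χ) is an integral effective
Cartier divisor of the regular (d+1)-fold V = total space of O_{ℙ^d}(i) (Proj k[y₀,…,y_d,w], deg w -/
@[route_item "route-ResolutionOfSingularities-MarkedTransfer", crux]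
def HypersurfaceToResolution : Prop :=
  HypersurfaceOrderReduction → ∀ p : ℕ, p.Prime → ∀ (k : Type) [Field k] [CharP k p] [PerfectField k] (X : AlgebraicGeometry.Scheme.{0}) (f : X ⟶ AlgebraicGeometry.Spec (.of k)), AlgebraicGeometry.IsSeparated f → AlgebraicGeometry.LocallyOfFiniteType f → AlgebraicGeometry.QuasiCompact f → AlgebraicGeometry.IsReduced X → Literature.AlgebraicGeometry.Resolution.Scheme.HasResolution X

/-- item stmt-ResolutionOfSingularities-0549 · crux · rank 4 · open · by planner
why it might fail: regular is not geometrically regular under inseparable k/K0 (EGA IV 6.7.4); resolve-a-model-then-base-change needs k/K0 separable, impossible beyond the p-rank of k; Frobenius twist resolves only a twist of X; open already for quadrics in char 2.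
sources: Temkin2008, CossartPiltant2009, Kollar2007, Literature.Barriers.ResolutionOfSingularities.InseparableBaseChange, Literature.Barriers.ResolutionOfSingularities.InseparableBaseChangeResolution
PerfectToAll: for a prime p, resolution of all reduced separated finite-type schemes over all
PERFECT fields of char p implies ResolutionInChar p (all fields of char p). Expected inputs:
Neron-Popescu (Stacks 07GC), spreading out, openness of regular locus on excellent schemes;
regularity is not stable under inseparable ground field extension, which is the difficulty. -/
@[route_item "route-ResolutionOfSingularities-MarkedTransfer", crux]
def DescentPerfectToAll : Prop :=
  ∀ p : ℕ, p.Prime → (∀ (k : Type) [Field k] [CharP k p] [PerfectField k] (X : AlgebraicGeometry.Scheme.{0}) (f : X ⟶ AlgebraicGeometry.Spec (.of k)), AlgebraicGeometry.IsSeparated f → AlgebraicGeometry.LocallyOfFiniteType f → AlgebraicGeometry.QuasiCompact f → AlgebraicGeometry.IsReduced X → Literature.AlgebraicGeometry.Resolution.Scheme.HasResolution X) → Literature.AlgebraicGeometry.Resolution.ResolutionInChar.{0} p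

/-- item stmt-ResolutionOfSingularities-15522 · support · rank 3 · open · by planner
why it might fail: an EXISTENTIAL simplification of each hypersurface H_i gives no invariant to synchronise the H_i of a presentation or to glue étale-local data; KM's Step 1 is local and consumes a canonical monomial-case procedure — the implication may be as hard as MOR_p.
sources: Villamayoru2014, BravoVillamayor2010, KawanoueMatsuki2016, BenitoVillamayoruriburu2015, Kollar2007
[crux] HYPERSURFACE PRESENTATIONS (the transferred induction frame, Kollár 3.70 with maximal contact
replaced by projection/elimination): hypersurface order reduction in char p implies marked order
reduction for ALL marked ideals (E = ∅) on regular varieties over perfect fields of char p, i.e.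
HypersurfaceOrderReduction → MarkedOrderReductionP. Printed inputs: étale-local presentation of the
top multiplicity locus by hypersurfaces F_n(X) = ∩ Sing(H_i, n_i) stable under permissible blow-ups
in any characteristic (Villamayoru2014 §1, §2.20), reduction to the monomial case in arbitrary
dimension (BravoVillamayor2010 Main Thm; KawanoueMatsuki2016 Step 1), and the printed claim that the
hypersurface monomial case yields resolution over arbitrary fields (BravoVillamayor2010 p. 4, citing
Benito–Villamayor). [deps: HypersurfaceOrderReduction] [difficulty: XL] -/
@[route_item "route-ResolutionOfSingularities-MarkedTransfer"]
def HypersurfaceToMarked : Prop :=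
  HypersurfaceOrderReduction → MarkedOrderReductionP

/-- item stmt-ResolutionOfSingularities-15523 · support · rank 9 · open · by planner
sources: Kollar2007, BierstoneGrigorievMilmanWlodarczyk2011, CossartPiltant2019
[support] the TRANSFERRED step S1 (Kollár 3.72 + Cor. 3.22 + projective reduction), char-free:
MarkedOrderReductionP ⇒ every reduced separated finite-type scheme over every perfect field of char
p has a resolution. PROVED in the route's glue (`orderReductionToResolution_proof` in Sketch.lean,
rc 0): a prover closes it by copying that proof into Theorems/ (uses
`IsMarkedResolution.hasResolution`, `isRegular_projectiveSpace`, `isIntegral_projectiveSpace`,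
`stub_projectiveIntegralSuffices`). [difficulty: provable-now] -/
@[route_item "route-ResolutionOfSingularities-MarkedTransfer"]
def OrderReductionToResolution : Prop :=
  MarkedOrderReductionP → ∀ p : ℕ, p.Prime → ∀ (k : Type) [Field k] [CharP k p] [PerfectField k] (X : AlgebraicGeometry.Scheme.{0}) (f : X ⟶ AlgebraicGeometry.Spec (.of k)), AlgebraicGeometry.IsSeparated f → AlgebraicGeometry.LocallyOfFiniteType f → AlgebraicGeometry.QuasiCompact f → AlgebraicGeometry.IsReduced X → Literature.AlgebraicGeometry.Resolution.Scheme.HasResolution X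

-- earlier HypersurfaceOrderReductionDimLeThree (stmt-ResolutionOfSingularities-15524, replaced 2026-08-16T16:26:02Z -> stmt-ResolutionOfSingularities-16156): retired by None — ∀ p : ℕ, p.Prime → ∀ (k : Type) [Field k] [CharP k p] [PerfectField k] (X : AlgebraicGeometry.Scheme.{0}) (s : X ⟶ AlgebraicGeometry.Spec (.of k)), AlgebraicGeometry.IsSeparated s → AlgebraicGeometry.LocallyOfFiniteType s → Al
/-- item stmt-ResolutionOfSingularities-16156 · support · rank 9 · open · by planner
sources: CossartJannsenSaito2020, KawanoueMatsuki2016, BenitoVillamayoru2011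
[support] CALIBRATION (known case): HypersurfaceOrderReduction (rev-1 typing, `IsEffectiveCartier`)
for X of topological Krull dimension ≤ 3 — order reduction for curves and SURFACES in regular
ambient schemes of dimension ≤ 3 with boundary, i.e. the B-permissible canonical embedded resolution
of two-dimensional excellent schemes (CossartJannsenSaito2020, Thm 1.3 / Ch. 5 with boundary) and
Kawanoue–Matsuki's IFP in dimension 3; expected to close modulo a cite fact for CJS. [difficulty: L] -/
@[route_item "route-ResolutionOfSingularities-MarkedTransfer"]
def HypersurfaceOrderReductionDimLeThree : Prop :=
  ∀ p : ℕ, p.Prime → ∀ (k : Type) [Field k] [CharP k p] [PerfectField k] (X : AlgebraicGeometry.Scheme.{0}) (s : X ⟶ AlgebraicGeometry.Spec (.of k)), AlgebraicGeometry.IsSeparated s → AlgebraicGeometry.LocallyOfFiniteType s → AlgebraicGeometry.QuasiCompact s → AlgebraicGeometry.IsIntegral X → Literature.AlgebraicGeometry.Resolution.Scheme.IsRegular X → topologicalKrullDim X ≤ 3 → ∀ (I : X.IdealSheafData), I ≠ ⊥ → Literature.AlgebraicGeometry.Resolution.IsEffectiveCartier I → ∀ (E : List X.IdealSheafData), Literature.AlgebraicGeometry.Resolution.HasSNC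 E → ∀ (m : ℕ), 1 ≤ m → ∃ (X' : AlgebraicGeometry.Scheme.{0}) (Φ : X' ⟶ X) (M' : Literature.AlgebraicGeometry.Resolution.MarkedIdeal X'), Literature.AlgebraicGeometry.Resolution.IsMarkedResolution (⟨I, E, m⟩ : Literature.AlgebraicGeometry.Resolution.MarkedIdeal X) Φ M'

-- earlier Assembly (stmt-ResolutionOfSingularities-15525, replaced 2026-08-16T16:26:02Z -> stmt-ResolutionOfSingularities-16157): retired by None — HypersurfaceOrderReduction → HypersurfaceToMarked → DescentPerfectToAll → _root_.ResolutionOfSingularities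
-- earlier Assembly (stmt-ResolutionOfSingularities-16157, replaced 2026-08-16T16:51:21Z -> stmt-ResolutionOfSingularities-15884): retired by None — HypersurfaceOrderReduction → HypersurfaceToMarked → OrderReductionToResolution → DescentPerfectToAll → _root_.ResolutionOfSingularities
/-- item stmt-ResolutionOfSingularities-15884 · assembly · rank 1 · open · by planner
sources: Kollar2007
[assembly] HypersurfaceOrderReduction → HypersurfaceToResolution → DescentPerfectToAll → the summit
(the type of the rev-2 crux-only deciding theorem `closes`; provable at once from it: `fun hA hB hD
=> closes hA hB hD`). -/
@[route_item "route-ResolutionOfSingularities-MarkedTransfer"]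
def Assembly : Prop :=
  HypersurfaceOrderReduction → HypersurfaceToResolution → DescentPerfectToAll → _root_.ResolutionOfSingularities

/-! D-0027 §2.1 — DECIDING THEOREM (planner-authored via `route open/edit --closes-file`; by planner-rrepair-ResolutionOfSingularities-Mark-6ec7f187-g2-0 2026-08-16T16:51:21Z):
its hypotheses are this route's items and its conclusion the sub-problem Statement (glue_lint), and it elaborates with this file. -/

/-- DECIDING THEOREM of route MarkedTransfer (D-0027 §2.1; transfer lens), rev 2 (glue repair 2026-08-16:
crux-only hypotheses, human ruling 2026-08-16 / `glue.non-crux-hypothesis`).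
Hypotheses = the three cruxes `HypersurfaceOrderReduction` (rank 2: hypersurface order reduction in
characteristic `p` over perfect fields — the one step of Kollár's characteristic-zero proof that does not
transfer), `HypersurfaceToResolution` (rank 3: it implies resolution of every reduced separated finite-type
scheme over every PERFECT field of characteristic `p` — either directly, through a finite birational
hypersurface model `Z → H ⊂ V` of each integral projective `Z` in a regular `V` (Kedlaya 2005 Thm 1 /
generic projection, `IsMarkedResolution.hasResolution`, `stub_finiteBirationalTransfer`,
`stub_projectiveIntegralSuffices`), or through the transferred sibling theorem `MarkedOrderReductionP`
(supports `HypersurfaceToMarked` and `OrderReductionToResolution` = Kollár 3.70 frame + 3.72/Cor. 3.22)) and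
`DescentPerfectToAll` (rank 4, stmt-0549 shared: perfect fields ⇒ all fields). No support is assumed.
Derivation: fix a prime `p`; `hB hA p hp` is resolution over perfect fields of characteristic `p`
(verbatim the antecedent of `DescentPerfectToAll p hp`); `hD p hp` upgrades it to `ResolutionInChar p`.
Pure logic over the route's own decls; the file imports only `MarkedIdeals` (no unproved fact in cone).
[cite: Kollar2007, Thm. 3.69, 3.72, Cor. 3.22] -/
@[closes "route-ResolutionOfSingularities-MarkedTransfer"] theorem closes (hA : HypersurfaceOrderReduction) (hB : HypersurfaceToResolution)
    (hD : DescentPerfectToAll) : _root_.ResolutionOfSingularities :=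
  fun p hp => hD p hp (hB hA p hp)

end Summit.ResolutionOfSingularities.ResolutionOfSingularities.Theses.MarkedTransfer
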